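/-
Copyright (c) 2026 the pub-hodgecm-mathlib formalisation cell (harness21).  Prover seat hodgecm-mathlib-LH4-p02 (g12): STAGE 1a «(D-RAM) FOUR-FRAME» road,
tier-1 module `U4_Rows` §2 (iv-a)·T3 (dealer LH4-plan (g10) WORD #24∕#26): the PAYER of `stub_U4_table_diag_ne_zero`; 2026-09-03.
-/
import Summits.HodgeConjecture.HodgeConjecture.Theorems.F0P3cDyRamTableDiagWitnessReg           -- ★ p854880 (this seat): `exists_mem_supportReg_mk_eq` (label `3`)
import Summits.HodgeConjecture.HodgeConjecture.Theorems.F0P3cDyRamTableDiagWitnessTransvMinus   -- ★ p854895 (this seat): `exists_mem_supportTransvMinus_mk_eq` (label `2`)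
import Summits.HodgeConjecture.HodgeConjecture.Theorems.F0P3cDyRamTableDiagWitnessTransvPlus    -- ★ (LH4-p13 (g0), split per dealer WORD #26): `exists_mem_supportTransvPlus_mk_eq` (label `1`)
import Summits.HodgeConjecture.HodgeConjecture.Theorems.F0P3cDyRamProfilePiecesProps            -- ★ p854742 (B-p08 (g41)): `isLocSmooth_pieceTransvPlus ∕ Minus ∕ Reg`
import Literature.NumberTheory.Automorphic.OrbitalIntegralIndicatorSeparation                     -- ★ p846366: `classOrbitalIntegral_indicator_ne_zero`, `measure_preimage_descConj_lt_top_of_integrable`; brings ★ `measure_preimage_descConj_pos`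
import Literature.NumberTheory.Rogawski1990.LocalTransferFundamentalLemma                         -- ★ `isLocSmooth_indicator_cmLocalIntegralLevel` (`1_K ∈ C_c^∞`), `IsLocSmooth`, `IsAdmissibleOn`
import HarnessLib

/-!
# Crux `H413`, line LH4 «(D-RAM) FOUR-FRAME», module `U4_Rows` §2 (iv-a)·T3: POSITIVITY OF THE LABEL DIAGONAL — `O_u(gselStar (unipotentLabel u)) ≠ 0` —
# `stub_U4_table_diag_ne_zero` BY NAME

Cell `hodgecm-mathlib` (D-0151), FLOOR 0, crux item H413 = `stmt-HodgeConjecture-24833`, route of record `HCCMUnconditional`; squad F0∕P3c∕LH4 Track A; dealer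
LH4-plan (g10) WORD #24 (T3 → this seat) ∕ #26 (split: the `T₊` witness → LH4-p13 (g0)).  THEOREMS ONLY (no `def`, no instance, no notation, no `sorry`, default
heartbeats); lane `--supports stmt-HodgeConjecture-24833 --as helper`.

WHAT IS PROVED.  `table_diag_ne_zero` = the registered text of `stub_U4_table_diag_ne_zero` of ★ `Cruxes/H413/Lines/F0_P3c_DyRamFourFrame_U4_Rows.lean` VERBATIM: for
every admissible unipotent datum `(S, mU)` (non-zero `G`-invariant orbital measures finite on compacts at the classes of `S`, with the Rao clause) at a ramified
`σ`-stable place, and every `u ∈ S`, the orbital integral over `u` of the piece `gselStar (unipotentLabel u) ∈ {1_K, f_{T+}, f_{T−}, f_reg}` is NON-ZERO.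
§1 THE ENGINE (the diagonal branch of ★ p846366 `det_classOrbitalIntegral_indicator_ne_zero`, isolated): for a piece `1_P` with `IsLocSmooth 1_P` (so `P` is open)
and a WITNESS `x ∈ P` in the class `u`, the trace set of `P` on the orbit is open and non-empty, hence of positive `mU u`-measure (★ `measure_preimage_descConj_pos`:
`mU u ≠ 0` and `G`-invariant), and of finite measure (Rao clause, ★ `measure_preimage_descConj_lt_top_of_integrable`), so `O_u(1_P) ≠ 0` (★
`classOrbitalIntegral_indicator_ne_zero`).  §2 THE HEAD: by the value of the label (★ №6 `unipotentLabel`, nested `if` on `X = wMatrix (out u) − 1`): label `0` ⇒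
`out u = 1 ∈ K` (★ T1 `eq_one_of_wMatrix_sub_one_eq_zero`); label `1` ⇒ the `T₊` witness ★ `exists_mem_supportTransvPlus_mk_eq` (LH4-p13); label `2` ⇒ the `T₋`
witness ★ p854895 `exists_mem_supportTransvMinus_mk_eq`; label `3` ⇒ the regular witness ★ p854880 `exists_mem_supportReg_mk_eq`; smoothness of the pieces ★ p854742 ∕
★ `isLocSmooth_indicator_cmLocalIntegralLevel`.  The stub's `¬ IsUnit 2` is carried, not used.

HONEST LABEL.  Count-neutral helper (`--supports 24833`); it pays the U4 module's T3 row BY NAME only when the dealer pastes it.  (D-RAM) verdict of record PRINT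
[LanglandsShelstad1989 Thm. p. 484 ∕ Rogawski1990 Prop. 4.9.1 (a)] ∕ XL; `HC_CM` is proved only modulo the 7 printed citations (2 remaining: hLiu418 =
`stmt-HodgeConjecture-24832`, h413 = `stmt-HodgeConjecture-24833`) until rung 0 closes.

## References
* [Rogawski1990] J. D. Rogawski, *Automorphic Representations of Unitary Groups in Three Variables*, Ann. of Math. Stud. 123 (1990), §8.1 p. 112 (orbital integrals
  of characteristic functions), §3.9 Prop. 3.9.1 p. 32, §4.9 Prop. 4.9.1 (b) p. 55.
* [HarishChandra1999AdmissibleDistributions] Harish-Chandra, *Admissible Invariant Distributions on Reductive p-adic Groups*, AMS ULS 16 (1999), §3.1 p. 17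
  (orbital integrals as invariant Radon measures on the orbit).
-/

noncomputable section

namespace Summit.HodgeConjecture.HodgeConjecture.Cruxes.H413.F0P3cDyRamTableDiagNeZero

open MeasureTheory NumberField IsDedekindDomain Topology
open Literature.NumberTheory.Automorphic Literature.NumberTheory.Automorphic.UnitaryGroup Literature.NumberTheory.Automorphic.IntegralReduction
open Literature.NumberTheory.Automorphic.HermitianLattice Literature.NumberTheory.Automorphic.UnitaryThreeFourFrame
open Literature.NumberTheory.Rogawski1990 Literature.NumberTheory.GaloisRepresentations
open Literature.MeasureTheory.Group
open Summit.HodgeConjecture.HodgeConjecture.Cruxes.H413.F0P3cDyRamFourFramePieces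
open Summit.HodgeConjecture.HodgeConjecture.Cruxes.H413.F0P3cDyRamFourFrameUnipotentLabelDefs
open Summit.HodgeConjecture.HodgeConjecture.Cruxes.H413.F0P3cDyRamUnipotentLabelInjOn
open Summit.HodgeConjecture.HodgeConjecture.Cruxes.H413.F0P3cDyRamProfilePiecesProps
open Summit.HodgeConjecture.HodgeConjecture.Cruxes.H413.F0P3cDyRamTableDiagWitnessReg
open Summit.HodgeConjecture.HodgeConjecture.Cruxes.H413.F0P3cDyRamTableDiagWitnessTransvMinus
open Summit.HodgeConjecture.HodgeConjecture.Cruxes.H413.F0P3cDyRamTableDiagWitnessTransvPlus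
open scoped Matrix MatrixGroups ValuativeRel

/-! ## §1 The engine: an `IsLocSmooth` indicator piece with a witness in the class has a non-zero orbital integral -/

/-- The set behind an `IsLocSmooth` indicator is open (a fibre of a locally constant function). [cite: Rogawski1990, §8.1 p. 112] -/
theorem isOpen_of_isLocSmooth_indicator {X : Type*} [TopologicalSpace X] {P : Set X} (h : IsLocSmooth (P.indicator fun _ => (1 : ℂ))) : IsOpen P := by
  have hP : P = (P.indicator fun _ => (1 : ℂ)) ⁻¹' {1} := by
    ext x
    by_cases hx : x ∈ P <;> simp [hx]
  rw [hP]
  exact h.1.isOpen_fiber 1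

section Engine

variable {G : Type*} [Group G] [TopologicalSpace G] [IsTopologicalGroup G] [SigmaCompactSpace G]
  [∀ γ : G, MeasurableSpace (G ⧸ Subgroup.centralizer ({γ} : Set G))] [∀ γ : G, BorelSpace (G ⧸ Subgroup.centralizer ({γ} : Set G))]

/-- **THE DIAGONAL ENGINE** (the diagonal branch of ★ `det_classOrbitalIntegral_indicator_ne_zero`, isolated): for an admissible datum `(S, mU)` with the Rao
clause, `u ∈ S`, and a piece `1_P` with `IsLocSmooth 1_P` having a WITNESS `x ∈ P` in the class `u`, `classOrbitalIntegral mU 1_P u ≠ 0` — the trace set is open and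
non-empty (positive measure: `mU u ≠ 0`, `G`-invariant) and of finite measure (Rao). [cite: Rogawski1990, §8.1 p. 112] [cite: HarishChandra1999AdmissibleDistributions, §3.1 p. 17] -/
theorem classOrbitalIntegral_indicator_ne_zero_of_exists_mem (S : Finset (ConjClasses G)) (mU : OrbitalMeasureFamily G)
    (hmU : mU.IsAdmissibleOn (fun γ => (ConjClasses.mk γ) ∈ S))
    (hRao : ∀ u ∈ S, ∀ f : G → ℂ, IsLocSmooth f →
      Integrable (descConj (Quotient.out u : G) (Subgroup.centralizer ({(Quotient.out u : G)} : Set G))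
        (fun _ hg => Subgroup.mem_centralizer_singleton_iff.1 hg) f) (mU u))
    {u : ConjClasses G} (hu : u ∈ S) {P : Set G} (hP : IsLocSmooth (P.indicator fun _ => (1 : ℂ))) (hx : ∃ x ∈ P, ConjClasses.mk x = u) :
    classOrbitalIntegral mU (P.indicator fun _ => (1 : ℂ)) u ≠ 0 := by
  have hPo : IsOpen P := isOpen_of_isLocSmooth_indicator hP
  have hout : ConjClasses.mk (Quotient.out u) = u := by rw [← ConjClasses.quotient_mk_eq_mk, Quotient.out_eq]
  obtain ⟨hm0, hinv, -⟩ := hmU u (show ConjClasses.mk (Quotient.out u) ∈ S by rw [hout]; exact hu)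
  obtain ⟨x, hxP, hxu⟩ := hx
  obtain ⟨y, hy⟩ := isConj_iff.1 (ConjClasses.mk_eq_mk_iff_isConj.1 (hout.trans hxu.symm))
  have hS : MeasurableSet (descConj (Quotient.out u) (Subgroup.centralizer ({(Quotient.out u : G)} : Set G))
      (fun _ hg => Subgroup.mem_centralizer_singleton_iff.1 hg) id ⁻¹' P) :=
    (hPo.preimage (continuous_descConj_id _ _ _)).measurableSet
  exact classOrbitalIntegral_indicator_ne_zero mU P u hPo (measure_preimage_descConj_pos _ (mU u) hm0 hPo ⟨y, hy.symm ▸ hxP⟩)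
    (measure_preimage_descConj_lt_top_of_integrable _ (mU u) P hS (hRao u hu _ hP))

end Engine

/-! ## §2 The head: `stub_U4_table_diag_ne_zero` of the U4 module, VERBATIM -/

/-- **(iv-a)·T3 POSITIVITY — THE LABEL-DIAGONAL ENTRIES `O_u(gselStar (unipotentLabel u))` ARE NON-ZERO** (the registered text of `stub_U4_table_diag_ne_zero` of ★
`Cruxes/H413/Lines/F0_P3c_DyRamFourFrame_U4_Rows.lean` §2, token for token): label `0` — the mass of `1_K` over `{1}` (`1 ∈ K`); label `1`∕`2` — a depth-`ℓ₀` shell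
transvection of the class `±` lies in `K` with the right level-`m*` label (★ LH4-p13 ∕ ★ p854895); label `3` — an integral regular unipotent of `K` with `X² ∉ ϖ^{m*}M₃(𝒪)`
(★ p854880); and an admissible orbital measure charges the open set it meets (§1). [cite: Rogawski1990, §8.1 p. 112; §3.9 Prop. 3.9.1 p. 32; §4.9 Prop. 4.9.1 (b) p. 55]
[cite: HarishChandra1999AdmissibleDistributions, §3.1 p. 17] -/
theorem table_diag_ne_zero :
    ∀ (L : Type) [Field L] [NumberField L] [IsCMField L]
      {v : HeightOneSpectrum (𝓞 ↥(maximalRealSubfield L))} (w : UnitaryGroup.PlacesOver L v)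
      (hw : IsCMField.complexConj L • w.1 = w.1) (_he : v.asIdeal.ramificationIdx' w.1.asIdeal ≠ 1)
      (_h2 : ¬ IsUnit (2 : 𝒪[w.1.adicCompletion L]))
      (ϖ : (w.1.adicCompletion L)) (_hϖ : Valued.v ϖ = WithZero.exp (-1 : ℤ))
      [MeasurableSpace ((UnitaryGroup.cmDatum L 3 (Matrix.of fun i j : Fin 3 => if i.val + j.val + 1 = 3 then (1 : L) else 0)).Local v)] [BorelSpace ((UnitaryGroup.cmDatum L 3 (Matrix.of fun i j : Fin 3 => if i.val + j.val + 1 = 3 then (1 : L) else 0)).Local v)]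
      [∀ γ : ((UnitaryGroup.cmDatum L 3 (Matrix.of fun i j : Fin 3 => if i.val + j.val + 1 = 3 then (1 : L) else 0)).Local v), MeasurableSpace (((UnitaryGroup.cmDatum L 3 (Matrix.of fun i j : Fin 3 => if i.val + j.val + 1 = 3 then (1 : L) else 0)).Local v) ⧸ Subgroup.centralizer ({γ} : Set ((UnitaryGroup.cmDatum L 3 (Matrix.of fun i j : Fin 3 => if i.val + j.val + 1 = 3 then (1 : L) else 0)).Local v)))]
      [∀ γ : ((UnitaryGroup.cmDatum L 3 (Matrix.of fun i j : Fin 3 => if i.val + j.val + 1 = 3 then (1 : L) else 0)).Local v), BorelSpace (((UnitaryGroup.cmDatum L 3 (Matrix.of fun i j : Fin 3 => if i.val + j.val + 1 = 3 then (1 : L) else 0)).Local v) ⧸ Subgroup.centralizer ({γ} : Set ((UnitaryGroup.cmDatum L 3 (Matrix.of fun i j : Fin 3 => if i.val + j.val + 1 = 3 then (1 : L) else 0)).Local v)))]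
      (S : Finset (ConjClasses ((UnitaryGroup.cmDatum L 3 (Matrix.of fun i j : Fin 3 => if i.val + j.val + 1 = 3 then (1 : L) else 0)).Local v)))
      (_hS : ∀ u ∈ S, (((Quotient.out u : ((UnitaryGroup.cmDatum L 3 (Matrix.of fun i j : Fin 3 => if i.val + j.val + 1 = 3 then (1 : L) else 0)).Local v)).val : GL (Fin 3) (UnitaryGroup.LocalRing L v)).val - 1) ^ 3 = 0)
      (mU : OrbitalMeasureFamily ((UnitaryGroup.cmDatum L 3 (Matrix.of fun i j : Fin 3 => if i.val + j.val + 1 = 3 then (1 : L) else 0)).Local v)) (_hmU : mU.IsAdmissibleOn (fun γ => (ConjClasses.mk γ) ∈ S))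
      (_hRao : ∀ u ∈ S, ∀ f : ((UnitaryGroup.cmDatum L 3 (Matrix.of fun i j : Fin 3 => if i.val + j.val + 1 = 3 then (1 : L) else 0)).Local v) → ℂ, IsLocSmooth f →
        Integrable (descConj (Quotient.out u : ((UnitaryGroup.cmDatum L 3 (Matrix.of fun i j : Fin 3 => if i.val + j.val + 1 = 3 then (1 : L) else 0)).Local v))
          (Subgroup.centralizer ({(Quotient.out u : ((UnitaryGroup.cmDatum L 3 (Matrix.of fun i j : Fin 3 => if i.val + j.val + 1 = 3 then (1 : L) else 0)).Local v))} : Set ((UnitaryGroup.cmDatum L 3 (Matrix.of fun i j : Fin 3 => if i.val + j.val + 1 = 3 then (1 : L) else 0)).Local v)))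
          (fun _ hg => Subgroup.mem_centralizer_singleton_iff.1 hg) f) (mU u)),
      ∀ u : ↥S, classOrbitalIntegral mU ((gselStar (unipotentLabel L w hw ϖ (u : ConjClasses ((UnitaryGroup.cmDatum L 3 (Matrix.of fun i j : Fin 3 => if i.val + j.val + 1 = 3 then (1 : L) else 0)).Local v)))) L v w hw ϖ) u ≠ 0 := by
  intro L _ _ _ v w hw he _h2 ϖ hϖ _ _ _ _ S hS mU hmU hRao u
  have hout : ConjClasses.mk (Quotient.out (u : ConjClasses ((UnitaryGroup.cmDatum L 3 (Matrix.of fun i j : Fin 3 => if i.val + j.val + 1 = 3 then (1 : L) else 0)).Local v))) =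
      (u : ConjClasses ((UnitaryGroup.cmDatum L 3 (Matrix.of fun i j : Fin 3 => if i.val + j.val + 1 = 3 then (1 : L) else 0)).Local v)) := by
    rw [← ConjClasses.quotient_mk_eq_mk, Quotient.out_eq]
  by_cases h0 : wMatrix L w hw (Quotient.out (u : ConjClasses ((UnitaryGroup.cmDatum L 3 (Matrix.of fun i j : Fin 3 => if i.val + j.val + 1 = 3 then (1 : L) else 0)).Local v))) - 1 = 0
  · -- label `0`: the piece `1_K`, witness `out u = 1`
    have hℓ : unipotentLabel L w hw ϖ (u : ConjClasses ((UnitaryGroup.cmDatum L 3 (Matrix.of fun i j : Fin 3 => if i.val + j.val + 1 = 3 then (1 : L) else 0)).Local v)) = 0 := by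
      unfold unipotentLabel; rw [if_pos h0]
    rw [hℓ]
    show classOrbitalIntegral mU (pieceUnit0 L v w hw ϖ) u ≠ 0
    exact classOrbitalIntegral_indicator_ne_zero_of_exists_mem S mU hmU hRao u.2
      (isLocSmooth_indicator_cmLocalIntegralLevel L 3 (Matrix.of fun i j : Fin 3 => if i.val + j.val + 1 = 3 then (1 : L) else 0) v)
      ⟨Quotient.out (u : ConjClasses ((UnitaryGroup.cmDatum L 3 (Matrix.of fun i j : Fin 3 => if i.val + j.val + 1 = 3 then (1 : L) else 0)).Local v)),
        by rw [eq_one_of_wMatrix_sub_one_eq_zero L w hw h0]; exact one_mem _, hout⟩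
  by_cases hsq : (wMatrix L w hw (Quotient.out (u : ConjClasses ((UnitaryGroup.cmDatum L 3 (Matrix.of fun i j : Fin 3 => if i.val + j.val + 1 = 3 then (1 : L) else 0)).Local v))) - 1) *
      (wMatrix L w hw (Quotient.out (u : ConjClasses ((UnitaryGroup.cmDatum L 3 (Matrix.of fun i j : Fin 3 => if i.val + j.val + 1 = 3 then (1 : L) else 0)).Local v))) - 1) = 0
  · by_cases hN : NormClassPlus (galAdicCompletionMap (L := L) (IsCMField.complexConj L) hw) ϖ (dOfPlace L v w)
        (wMatrix L w hw (Quotient.out (u : ConjClasses ((UnitaryGroup.cmDatum L 3 (Matrix.of fun i j : Fin 3 => if i.val + j.val + 1 = 3 then (1 : L) else 0)).Local v))) - 1)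
    · -- label `1`: the piece `f_{T+}`, witness `n(t₊)` (★ LH4-p13)
      have hℓ : unipotentLabel L w hw ϖ (u : ConjClasses ((UnitaryGroup.cmDatum L 3 (Matrix.of fun i j : Fin 3 => if i.val + j.val + 1 = 3 then (1 : L) else 0)).Local v)) = 1 := by
        unfold unipotentLabel; rw [if_neg h0, if_pos hsq, if_pos hN]
      rw [hℓ]
      show classOrbitalIntegral mU (pieceTransvPlus L v w hw ϖ) u ≠ 0
      exact classOrbitalIntegral_indicator_ne_zero_of_exists_mem S mU hmU hRao u.2 (isLocSmooth_pieceTransvPlus L w hw hϖ).1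
        (exists_mem_supportTransvPlus_mk_eq L w hw he ϖ hϖ _ h0 hsq hN)
    · -- label `2`: the piece `f_{T−}`, witness `n(η t₊)` (★ p854895)
      have hℓ : unipotentLabel L w hw ϖ (u : ConjClasses ((UnitaryGroup.cmDatum L 3 (Matrix.of fun i j : Fin 3 => if i.val + j.val + 1 = 3 then (1 : L) else 0)).Local v)) = 2 := by
        unfold unipotentLabel; rw [if_neg h0, if_pos hsq, if_neg hN]
      rw [hℓ]
      show classOrbitalIntegral mU (pieceTransvMinus L v w hw ϖ) u ≠ 0
      exact classOrbitalIntegral_indicator_ne_zero_of_exists_mem S mU hmU hRao u.2 (isLocSmooth_pieceTransvMinus L w hw hϖ).1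
        (exists_mem_supportTransvMinus_mk_eq L w hw he ϖ hϖ _ h0 hsq hN)
  · -- label `3`: the piece `f_reg`, witness `u(ϖ^k, −θ N(ϖ^k))` (★ p854880)
    have hℓ : unipotentLabel L w hw ϖ (u : ConjClasses ((UnitaryGroup.cmDatum L 3 (Matrix.of fun i j : Fin 3 => if i.val + j.val + 1 = 3 then (1 : L) else 0)).Local v)) = 3 := by
      unfold unipotentLabel; rw [if_neg h0, if_neg hsq]
    rw [hℓ]
    show classOrbitalIntegral mU (pieceReg L v w hw ϖ) u ≠ 0
    exact classOrbitalIntegral_indicator_ne_zero_of_exists_mem S mU hmU hRao u.2 (isLocSmooth_pieceReg L w hw hϖ).1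
      (exists_mem_supportReg_mk_eq L w hw he ϖ hϖ _ (hS _ u.2) hsq)

end Summit.HodgeConjecture.HodgeConjecture.Cruxes.H413.F0P3cDyRamTableDiagNeZero

end
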